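import Summits.QuantumFields.BalabanUV.T4Continuum.Support.NE7K1LinBlochSymbol
import Literature.MathematicalPhysics.QuantumFieldTheory.Balaban1983to89.B4TorusKernel

/-!
# NE7K1LinBlochSymbolTorus — row NE7 (node U5), candidate route HOM, path H1L, cell K1-lin(s): NEEDS-ESTIMATE #E1, B-E1 TYPED —
# THE TORUS DESCENT OF THE CONTINUUM BLOCK-MEAN MULTIPLIER: the finite-torus kernel of `k_L` (torus Fourier inversion of its samples at
# the dual momenta) IS the periodisation of its unit-lattice kernel and decays exponentially in the TORUS METRIC, uniformly in the
# period vector and in `L ≥ 1` — `B4TorusKernel.MultiPeriod.torusKernel_descend_eq ∕ _decay_torusMetric` BY NAME on file 48's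
# `kL_stripRegular` (lens 2 g67's docking (α) of N-67-1)

Lineage `b2b-balaban-t4-ne7-p2` (CRUX PROVER NE7 #2), generation 74; file 53.  File 48 proved `StripRegular (kL L) κ_N(D) (16D∕c_N(D))`.
Lens 2's N-67-1 (INBOX L.36661): the finite-torus symbol of files 36–46 and the continuum multiplier agree only on the dual lattice;
«the engine reaches the torus by Poisson descent of the CONTINUUM multiplier (`B4Torus248Decay`: for a strip-regular multiplier the
torus kernel sampled at the dual-torus momenta is the periodisation of its lattice kernel — `B4TorusKernel`'s
`MultiPeriod.torusKernel_descend_eq`, consumer `kernel248_torusKernel_decay_torusMetric`)».  THIS FILE performs that descent for `k_L`,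
verbatim in the shape of `B4Torus248Decay` ([folklore], joiner):

* `kLTorusKernel L N x := (Π_μ N_μ)⁻¹ Σ_{k ∈ Π_μ ℤ∕N_μ} k_L(2π rep(k∕N)) · Π_μ e^{2πi k_μ x_μ∕N_μ}` — the finite-torus kernel of the
  block-mean multiplier on the coarse torus `Π_μ ℤ∕N_μ` (an explicit finite sum);
* `kLTorusKernel_eq_torusKernel` — it is `MultiPeriod.torusKernel (descendC (kL L) …) N x` (definitional);
* **`kLTorusKernel_eq_periodise`** — `kLTorusKernel L N x = Σ_{m ∈ ℤ^D} latticeKernel (kL L) (x + (N_μ m_μ)_μ)` for every period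
  vector with all `N_μ ≥ 1` («relating the torus to the whole lattice in the usual way»);
* **`kLTorusKernel_decay_torusMetric`** — `‖kLTorusKernel L N x‖ ≤ (16D∕c_N(D))·periodConst κ_N(D) d·e^{−(κ_N(D)∕(d+1))·torusSupNorm N x}`
  for EVERY `L ≥ 1`, EVERY period vector (`N_μ ≥ 1`) and every `x ∈ ℤ^D` — uniform in `L` AND in the volume; `kLTorusKernel_decay`
  (centred form).

HONEST FRAMING: [folklore] (a by-name joiner over the tree's engines `B4ContourShift` ∕ `B4TorusKernel`); existence-grade d-only
constants; the IDENTIFICATION of `kLTorusKernel` with the row of the block-mean Schur complement `K_L^𝕋` of files 36–37 (lens 2's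
CLAIM (I): `torSymb(s=1) = n²k_L(2πp∕P)` at dual momenta, per-fibre KKT) is NOT typed — so this is the torus kernel OF THE MULTIPLIER,
not yet of the operator; R-E1 untouched; nothing of Bałaban's asserted; no `sorry`.  Census only; NE7 NOT PRINTED ∕ NOT PROVED;
spine 0∕9; FIXED FINITE T⁴, rung (B)+1; NOT infinite volume, NOT mass gap, NOT Clay.  HONEST DEPENDENCY: continuum YM on T⁴ ⇐
BetaPertH ∧ nine spine estimates (0/9 proved); BetaPertH ⇐ (D1) ∧ (D4) ∧ CAP+tail; G-an2-4 gates asym, D1 and NE2/3/4.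
-/

noncomputable section

open Finset Complex Set UnitAddTorus

namespace Summit.QuantumFields.BalabanUV.T4Continuum.NE7K1LinBlochSymbolTorus

open Literature.MathematicalPhysics.QuantumFieldTheory.Balaban1983to89
open Literature.MathematicalPhysics.QuantumFieldTheory.Balaban1983to89.B4Strip
open Literature.MathematicalPhysics.QuantumFieldTheory.Balaban1983to89.B4ContourShift
open Literature.MathematicalPhysics.QuantumFieldTheory.Balaban1983to89.B4TorusKernel
open NE7K1LinBlochDenominator NE7K1LinBlochSymbol
open scoped Real

variable {d : ℕ}

/-- THE FINITE-TORUS KERNEL OF THE BLOCK-MEAN MULTIPLIER on the coarse torus `Π_μ ℤ∕N_μ`: at separation `x ∈ ℤ^D`,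
`(Π_μ N_μ)⁻¹ Σ_{k ∈ Π_μ ℤ∕N_μ} k_L(p_k) e^{i p_k·x}`, `p_{k,μ} = 2π rep(k_μ∕N_μ) ∈ (2π∕N_μ)ℤ ∩ [−π,π)` (torus Fourier inversion of the
samples of `k_L` at the dual momenta; the shape of `B4Torus248Decay.torusKernel248`). [folklore] -/
def kLTorusKernel (L : ℕ) [NeZero L] (N : Fin (d + 1) → ℕ) (x : Fin (d + 1) → ℤ) : ℂ :=
  (∏ i, ((N i : ℕ) : ℂ))⁻¹ * ∑ k : (i : Fin (d + 1)) → Fin (N i),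
    kL L (ofRealVec (fun i => 2 * π * rep (MultiPeriod.gridPt N k i))) * mFourier x (MultiPeriod.gridPt N k)

/-- the finite-torus kernel is the engine's `MultiPeriod.torusKernel` of the descended multiplier (definitional). [folklore] -/
theorem kLTorusKernel_eq_torusKernel (L : ℕ) [NeZero L] (N : Fin (d + 1) → ℕ) (x : Fin (d + 1) → ℤ) :
    kLTorusKernel L N x = MultiPeriod.torusKernel (descendC _ (kL_stripRegular (d := d) L) (kappaN_pos _).le) N x := rfl

/-- PERIODICITY: `kLTorusKernel L N (x + (N_μ m_μ)_μ) = kLTorusKernel L N x`. [folklore] -/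
theorem kLTorusKernel_translate (L : ℕ) [NeZero L] {N : Fin (d + 1) → ℕ} (hN : ∀ i, 1 ≤ N i) (x m : Fin (d + 1) → ℤ) :
    kLTorusKernel L N (MultiPeriod.translate N x m) = kLTorusKernel L N x := by
  unfold kLTorusKernel
  congr 1
  exact Finset.sum_congr rfl fun k _ => by rw [MultiPeriod.mFourier_translate_gridPt hN x m k]

/-- **THE TORUS KERNEL OF `k_L` IS THE PERIODISATION OF ITS LATTICE KERNEL** («relating G on the torus to G on the whole lattice in
the usual way»): for every period vector with all `N_μ ≥ 1` and every `L ≥ 1`,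
`kLTorusKernel L N x = Σ_{m ∈ ℤ^D} latticeKernel (kL L) (x + (N_μ m_μ)_μ)` (`MultiPeriod.torusKernel_descend_eq` on file 48's
`kL_stripRegular`). [folklore] -/
theorem kLTorusKernel_eq_periodise (L : ℕ) [NeZero L] {N : Fin (d + 1) → ℕ} (hN : ∀ i, 1 ≤ N i) (x : Fin (d + 1) → ℤ) :
    kLTorusKernel L N x = ∑' m : Fin (d + 1) → ℤ, latticeKernel (kL L) (MultiPeriod.translate N x m) := by
  rw [kLTorusKernel_eq_torusKernel]
  exact MultiPeriod.torusKernel_descend_eq (kL_stripRegular (d := d) L) (kappaN_pos _) hN x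

/-- **UNIFORM EXPONENTIAL DECAY OF THE TORUS KERNEL OF `k_L` IN THE TORUS METRIC**: for EVERY `L ≥ 1`, every period vector with all
`N_μ ≥ 1` and every `x ∈ ℤ^D`,
`‖kLTorusKernel L N x‖ ≤ (16D∕c_N(D)) · periodConst κ_N(D) d · e^{−(κ_N(D)∕(d+1)) · torusSupNorm N x}` — constants in `d` alone, uniform
in `L` AND in the volume (`MultiPeriod.torusKernel_descend_decay_torusMetric`). [folklore] -/
theorem kLTorusKernel_decay_torusMetric (L : ℕ) [NeZero L] {N : Fin (d + 1) → ℕ} (hN : ∀ i, 1 ≤ N i) (x : Fin (d + 1) → ℤ) :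
    ‖kLTorusKernel L N x‖ ≤ 16 * (d + 1 : ℕ) / cN (d + 1) * periodConst (kappaN (d + 1)) d *
      Real.exp (-(kappaN (d + 1) / (d + 1) * MultiPeriod.torusSupNorm N x)) := by
  rw [kLTorusKernel_eq_torusKernel]
  exact MultiPeriod.torusKernel_descend_decay_torusMetric (kL_stripRegular (d := d) L) (kappaN_pos _) hN x

/-- the centred form: for `2|x_μ| ≤ N_μ` the decay is in the lattice sup norm `|x|_∞`, same constants. [folklore] -/
theorem kLTorusKernel_decay (L : ℕ) [NeZero L] {N : Fin (d + 1) → ℕ} (hN : ∀ i, 1 ≤ N i) (x : Fin (d + 1) → ℤ)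
    (hx : ∀ i, 2 * |x i| ≤ N i) :
    ‖kLTorusKernel L N x‖ ≤ 16 * (d + 1 : ℕ) / cN (d + 1) * periodConst (kappaN (d + 1)) d *
      Real.exp (-(kappaN (d + 1) / (d + 1) * supNorm x)) := by
  rw [← MultiPeriod.torusSupNorm_of_centred hN hx]
  exact kLTorusKernel_decay_torusMetric L hN x

end Summit.QuantumFields.BalabanUV.T4Continuum.NE7K1LinBlochSymbolTorus

end
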